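import Literature.NumberTheory.EllipticCurves.PAdicLFunctionZeroAtMinusTwoProofs
import Literature.NumberTheory.EllipticCurves.PAdicLFunctionIntegralityAtTwoAutoProofs
import Literature.NumberTheory.EllipticCurves.PAdicLFunctionNeZeroHoldsProofs
import Literature.NumberTheory.EllipticCurves.KatoRankBoundLevelZeroProofs
import Literature.NumberTheory.EllipticCurves.SelmerCorankHolds
import Literature.NumberTheory.EllipticCurves.PAdicLFunctionIntegralityAtTwoQuarterProofs
import Literature.NumberTheory.EllipticCurves.PAdicLFunctionDistributionHoldsProofs
import Literature.Barriers.BirchSwinnertonDyer.PAdicFunctionalEquationParityAnyPrimeProofs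
import Literature.NumberTheory.EllipticCurves.CuspFormTwistRatPlusSymbol
import Literature.NumberTheory.EllipticCurves.Gamma1PeriodLatticeTwistProofs
import HarnessLib

/-!
# [Part A of 8 — §AnyLevel, §Eighth; planner p2 GEN 40–42 kernel `Chi8Floor` v10 (HOME/p2/g43/lean/Chi8Floor_v10.lean, sha bc257584), split into ≤400-line tree files A–H by the lead star-p1 GEN 18 at the planner's LANDING ASK; namespace `Summit.BirchSwinnertonDyer.Rank2`]
# The χ₈-floor certificate: `ord_{T=0} L₂(E,T) ≤ 3` (and `= 2`, `= 3`) from the 2-adic size of one twisted value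

For `E/ℚ` (globally minimal model `W`) with good ORDINARY reduction at `2` and newform `f` write
`L₂(E,T) = ∑_k c_k T^k` (`padicLFunction f (unitRoot W 2)`, periods `Ω⁺_f`, `γ = 5`) and
`S₈(f) = ∑_{a mod 8} χ₈(a) [a/8]⁺_f ∈ ℚ` (`ratTwistedSymbolSum`; by Birch's formula a non-zero rational
multiple of `L(E^{(2)},1)/Ω`, `E^{(2)}` the twist by `ℚ(√2)`).

**Theorem (χ₈-floor).** If `‖c_k‖₂ ≤ 2^{-m}` for all `k` and `‖S₈(f)‖₂ > 2^{-(m+4)}` (i.e.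
`v₂(S₈(f)) ≤ m + 3`), then `ord_{T=0} L₂(E,T) ≤ 3` (`order_padicLFunction_le_three_of_chi8Floor`, any
level; in general `v₂(S₈(f)) ≤ m + n ⇒ ord ≤ n`, `order_padicLFunction_le_of_chi8Floor`, and
PARITY-FREE doors `rank_eq_selmerCorank_eq_order_of_chi8Floor(₀)` /
`rank_eq_selmerCorank_eq_order_of_eighthSymbol₀`: planted rank `≥ n` + `v₂(S₈) ≤ n` + Kato ⇒ all `= n`). *Proof.* If `ord ≥ 4` then `c₀ = ⋯ = c₃ = 0`, so every term of `∑_k c_k (−2)^k` has norm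
`≤ 2^{-m}·2^{-k} ≤ 2^{-(m+4)}` and, `ℂ₂` being ultrametric, so has the sum; but the sum is `α⁻³ S₈(f)`
(MTT interpolation at `χ₈`, `hasSum_coeff_padicLFunction_two_neg_two`) with `‖α‖ = 1`. ∎

Consequences (newform at the conductor level, where the `p`-adic parity theorem
`rootNumber_eq_neg_one_pow_order_padicLFunction_conductorLevel_anyPrime` lives):
* `w_E = +1`, `L(E,1) = 0` ⇒ `ord_{T=0} L₂(E,T) = 2` (`order_padicLFunction_eq_two_of_chi8Floor`;
  `…₀` is the unconditional `m = 0` form, the divisibility being INT2-AUTO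
  `padicLFunction_integral_two_auto`);
* THE EQUALITY DOORS: granting Kato's bound at `2` (`kato_selmerCorank_le_order_padicLFunction_allPrimes W 2`,
  the only named input), a planted `rank E(ℚ) ≥ 2` with `w_E = +1`, resp. a planted `rank E(ℚ) ≥ 3`
  (no sign hypothesis, any level), gives `rank = corank_{ℤ₂} Sel_{2^∞} = ord_{T=0} L₂ = 2`, resp. `= 3`,
  and `corank Ш(E)[2^∞] = 0` (`rank_eq_selmerCorank_eq_order_eq_two_of_chi8Floor(₀)`,
  `rank_eq_selmerCorank_eq_order_eq_three_of_chi8Floor(₀)`).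

**The eighth-symbol form.** When `L(E,1) = 0` the Hecke relation at `2` (MTT (4.2)) at the cusps
`0, 1/2, 1/4` and `[r+1]⁺ = [r]⁺ = [−r]⁺` give `[1/2]⁺ = [1/4]⁺ = 0`, `[3/8]⁺ = [5/8]⁺ = −[1/8]⁺`,
`[7/8]⁺ = [1/8]⁺`, hence **`S₈(f) = 4·[1/8]⁺_f`** (`ratTwistedSymbolSum_χ₈_eq_four_mul_eighth`): the
whole certificate is a condition on ONE modular symbol, `v₂([1/8]⁺_f) ≤ m + 1` — at `m = 0`:
**`[1/8]⁺_f` odd or `≡ 2 (mod 4)` ⇒ `ord_{T=0} L₂(E,T) = 2`** (`order_padicLFunction_eq_two_of_eighthSymbol₀`,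
doors `rank_eq_selmerCorank_eq_order_eq_two_of_eighthSymbol₀` / `…_three_…`).

**The twist habitat and the lattice engine (§TwistEngine, §TwistDoor, §LatticeEngine, §TwistDoorProved).**
For a rank-2 base newform `f₀` (odd level `N₀`, `L(f₀,1) = 0`, `[1/8]⁺_{f₀}` odd) and a prime `q ≡ 1 (mod 4)`,
`q ∤ N₀`, the eighth symbol of the twisted newform `F = f₀ ⊗ χ_q` (curve `E₀^{(q)}`) is
`c · ∑_u χ_q(u)[1/8 + u/q]⁺_{f₀}` (`exists_rat_forall_ratPlusSymbol_charTwist_eq`), and Hecke at `q/8` gives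
`∑_u χ_q(u)[1/8 + u/q]⁺ = a_q[q/8]⁺ − 2[1/8]⁺ − 2∑_{(u/q)=−1}[1/8 + u/q]⁺` (`twistedEighthSum_eq`), so it is a
`2`-adic unit as soon as `a_q` is odd and the QNR half-sum is an INTEGER (`norm_twistedEighthSum_eq_one`).
The LATTICE ENGINE proves the latter (`qnrHalfSum_eq_two_mul_of_realLattice`): the QNR half-sum of the
complex symbols `{∞, 1/8 + u/q}_{f₀}` is a period (Manin, `L(f₀,1) = 0`), it is REAL once `{∞,1/8}`, `{∞,q/8}`
and `∑_u χ_q(u){∞,1/8+u/q} = g(χ_q){∞,1/8}_F` are real — forced by the vanishing of the `χ₋₄`/`χ₋₈`-twisted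
symbol sums of `f₀` and of `F` (`im_modularSymbol_eighths_eq_zero`; Birch: these are the central values of the
odd twists `E₀^{(−1)}, E₀^{(−2)}, E₀^{(−q)}, E₀^{(−2q)}`, all of root number `−1` when `N₀ ≡ 1 (mod 8)` and
`χ_q(N₀) = 1`) — and a real period is an INTEGER multiple of `Ω⁺` when `Λ_{f₀}` is non-rectangular
(`Δ(E₀) < 0`). Door: `rank_eq_two_of_twistedEighth_forcedZeros` (Kato at `2` + planted rank `≥ 2` ⇒
`rank = corank Sel_{2^∞} = ord_T L₂ = 2`, `Ш[2^∞]` finite) and, with no Kato and no points,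
`order_padicLFunction_le_two_of_twistedEighth_forcedZeros` (`ord_T L₂(E₀^{(q)},T) ≤ 2`) — an INFINITE
(Chebotarev) class of rank-2-candidate twists per base curve (numerics: kit j326305/j326394, law 2497/2497).
§ElementaryDischarges / §TwistDoorStreamlined remove three side inputs (`g(χ_q)` real:
`im_gaussSum_eq_zero_of_isQuadratic_of_even`; `χ_q` is `ℤ`-valued and odd on units:
`exists_int_eq_of_isQuadratic`; `[q/8]⁺ = ±[1/8]⁺`: `norm_ratPlusSymbol_div_eight_eq`), giving
`rank_eq_two_of_twistedEighth_forcedZeros'` / `order_padicLFunction_le_two_of_twistedEighth_forcedZeros'`.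

No main conjecture, no `λ`/`μ` law and no `p`-adic height is used: extra zeros of `L₂(E,T)` in the
open disc (which make `λ` exceed the order) do not affect the valuation of `L₂(E,−2)` once the twisted
value sits at its 2-adic floor — equivalently, the certificate fires exactly when the extra zeros are
shallower than the probe point `T = −2`. HONEST FRAMING (cell bsd-rank2, Barrier B1): `ord_{T=0} L₂`
is the 2-adic analytic order, not `r_an = ord_{s=1} L(E,s)`; nothing here bears on `r_an`.
[cite: MazurTateTeitelbaum1986Invent, §I.14 Proposition (p. 20); Kato2004Asterisque, Thm. 18.4 (p. 281);
GreenbergLNM1716, §5 (p. 181)] §TwistDoorConductorLevel (v8): at the conductor level the `2`-adic functional equation makes the door KATO-FREE — `order_padicLFunction_eq_two_of_twistedEighth_forcedZeros'` (`w_E=+1`, `L(E,1)=0` ⇒ `ord_T L₂ = 2` exactly) and `twoAdicBSD_rank_of_twistedEighth_descent` (+ a `2`-descent `rank = 2`, `corank Ш[2^∞] = 0` ⇒ `corank Sel_{2^∞} = ord_T L₂ = rank = 2`; kit j326901: 152 instances). §ForcedZerosAnalytic + `…_analytic` doors (v9): the five symbol hypotheses (`{∞,0}=0`, `h4`, `h8m`,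 `h4F`, `h8F`) are replaced by central `L`-value vanishings `L(f₀,1) = L(f₀,χ₋₄,1) = L(f₀,χ₋₈,1) = L(F,χ₋₄,1) = L(F,χ₋₈,1) = 0` via Birch's formula (`twisted_LValue_eq_holds`) and `modularSymbol_zero_eq_holds` — theorems `order_padicLFunction_eq_two_of_twistedEighth_analytic`, `twoAdicBSD_rank_of_twistedEighth_analytic_descent`, `rank_eq_two_of_twistedEighth_analytic`. §PeriodFree + §TwistDoorFinal (v10): the period-unit hypothesis `hper` (`u·Ω⁺_F·g(χ) = Ω⁺_{f₀}`, `‖u‖₂ = 1`) is ELIMINATED — Stevens' proved lattice inclusion `g(χ)·Λ(f_χ) ⊆ Λ(f₀)` (`gaussSum_mul_mem_periodLattice_of_mem_charTwist`) and `g(χ) ∈ ℝ` give `g(χ)Ω⁺_F = k·Ω⁺_{f₀}`, `k ∈ ℤ`, so the twisting constant is `c = 1/k` with `‖c‖₂ ≥ 1` (`one_le_norm_twistConstant`) and `‖[1/8]⁺_F‖₂ ≥ 1` (`one_le_norm_ratPlusSymbol_charTwist_eighth(_of_forcedZeros)`); FINAL DOORS with analytic inputs and no period hypothesis: `order_padicLFunction_le_two_of_twistDoor`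 (any level, `L(E,1)=0 ⇒ ord ≤ 2`), `rank_eq_two_of_twistDoor` (any level, Kato + rank ≥ 2 ⇒ all `= 2`), `order_padicLFunction_eq_two_of_twistDoor` (conductor level, `w=+1`, Kato-free ⇒ `ord = 2`), `twoAdicBSD_rank_of_twistDoor_descent` (+ 2-descent). [cite: Stevens1989, Lemma (5.4)]
-/

noncomputable section

open PowerSeries WeierstrassCurve CongruenceSubgroup Filter
open Literature.NumberTheory.EllipticCurves Literature.NumberTheory.EllipticCurves.ModularForms
open Literature.Barriers.BirchSwinnertonDyer

namespace Summit.BirchSwinnertonDyer.Rank2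

/-- `‖−2‖ = 1/2` in `ℂ₂`. [folklore] -/
theorem norm_neg_two_padicComplex : ‖(-2 : ℂ_[2])‖ = (2 : ℝ)⁻¹ := by
  have h2 : (2 : ℂ_[2]) = algebraMap ℚ_[2] ℂ_[2] ((2 : ℕ) : ℚ_[2]) := by
    rw [map_natCast]; norm_num
  rw [norm_neg, h2, norm_algebraMap', Padic.norm_p]
  norm_num

section AnyLevel

variable {W : WeierstrassCurve ℚ} [W.IsElliptic] [W.IsGloballyMinimal]
  {N : ℕ} [NeZero N] {f : CuspForm (Gamma0 N) 2}

/-- **χ₈-floor certificate (any level, any order).** `E/ℚ` globally minimal, good ordinary at `2`,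
newform `f`; if `‖c_k‖₂ ≤ 2^{-m}` for every coefficient `c_k` of `L₂(E,T)` and
`‖S₈(f)‖₂ > 2^{-(m+n+1)}` (`v₂(S₈(f)) ≤ m + n`), then `ord_{T=0} L₂(E,T) ≤ n`. (Conversely
`v₂(S₈(f)) ≥ μ + ord_{T=0} L₂` is the trivial direction of `∑ c_k(−2)^k = α⁻³S₈(f)`.)
[cite: MazurTateTeitelbaum1986Invent, §I.14 Proposition (p. 20)] -/
theorem order_padicLFunction_le_of_chi8Floor
    (hord : IsOrdinaryAt W 2) (hf : IsNewformOf W f) (n m : ℕ)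
    (hdiv : ∀ k : ℕ, ‖padicLCoeff f (unitRoot W 2 : ℚ_[2]) k‖ ≤ (2 : ℝ)⁻¹ ^ m)
    (hS : (2 : ℝ)⁻¹ ^ (m + n + 1) <
      ‖((ratTwistedSymbolSum f (ZMod.χ₈.ringHomComp (Int.castRingHom ℚ)) : ℚ) : ℚ_[2])‖) :
    (padicLFunction f (unitRoot W 2 : ℚ_[2])).order ≤ n := by
  set L := padicLFunction f (unitRoot W 2 : ℚ_[2]) with hLdef
  by_contra hn
  push Not at hn
  -- the coefficients `c₀, …, c_n` vanish
  have hcoeff : ∀ k : ℕ, k < n + 1 → PowerSeries.coeff k L = 0 := fun k hk ↦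
    PowerSeries.coeff_of_lt_order k
      (lt_of_le_of_lt (by exact_mod_cast Nat.le_of_lt_succ hk) hn)
  -- every term of `∑ c_k (-2)^k` has norm `≤ 2^{-(m+n+1)}`
  have hα : ‖(unitRoot W 2 : ℚ_[2])‖ = 1 := (unitRoot_coe_spec (W := W) hord).2.1
  have hterm : ∀ k : ℕ,
      ‖algebraMap ℚ_[2] ℂ_[2] (PowerSeries.coeff k L) * (-2) ^ k‖ ≤ (2 : ℝ)⁻¹ ^ (m + n + 1) := by
    intro k
    by_cases hk : k < n + 1
    · rw [hcoeff k hk, map_zero, zero_mul, norm_zero]; positivity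
    · push Not at hk
      rw [norm_mul, norm_pow, norm_algebraMap', norm_neg_two_padicComplex, add_assoc, pow_add]
      have hc : ‖PowerSeries.coeff k L‖ ≤ (2 : ℝ)⁻¹ ^ m := by
        rw [hLdef, padicLFunction, PowerSeries.coeff_mk]; exact hdiv k
      have hp : ((2 : ℝ)⁻¹) ^ k ≤ (2 : ℝ)⁻¹ ^ (n + 1) :=
        pow_le_pow_of_le_one (by norm_num) (by norm_num) hk
      exact mul_le_mul hc hp (by positivity) (by positivity)
  -- hence so has the sum, which is `α⁻³ S₈(f)` with `‖α‖ = 1`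
  have hsum := hasSum_coeff_padicLFunction_two_neg_two hord hf
  rw [← hLdef] at hsum
  have hle : ‖algebraMap ℚ_[2] ℂ_[2] ((unitRoot W 2 : ℚ_[2])⁻¹ ^ 3) *
      ratTwistedSymbolSum f (ZMod.χ₈.ringHomComp (Int.castRingHom ℂ_[2]))‖ ≤
      (2 : ℝ)⁻¹ ^ (m + n + 1) := by
    rw [← hsum.tsum_eq]
    exact IsUltrametricDist.norm_tsum_le_of_forall_le_of_nonneg (by positivity) hterm
  rw [norm_mul, norm_algebraMap', norm_pow, norm_inv, hα, inv_one, one_pow, one_mul,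
    ratTwistedSymbolSum_χ₈_eq_cast f ℂ_[2],
    show (((ratTwistedSymbolSum f (ZMod.χ₈.ringHomComp (Int.castRingHom ℚ)) : ℚ) : ℂ_[2])) =
      algebraMap ℚ_[2] ℂ_[2]
        ((ratTwistedSymbolSum f (ZMod.χ₈.ringHomComp (Int.castRingHom ℚ)) : ℚ) : ℚ_[2]) by
      rw [map_ratCast], norm_algebraMap'] at hle
  exact absurd hS (not_lt.mpr hle)

/-- The case `n = 3`: `‖c_k‖₂ ≤ 2^{-m}` and `v₂(S₈(f)) ≤ m + 3` give `ord_{T=0} L₂(E,T) ≤ 3`.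
[cite: MazurTateTeitelbaum1986Invent, §I.14 Proposition (p. 20)] -/
theorem order_padicLFunction_le_three_of_chi8Floor
    (hord : IsOrdinaryAt W 2) (hf : IsNewformOf W f) (m : ℕ)
    (hdiv : ∀ k : ℕ, ‖padicLCoeff f (unitRoot W 2 : ℚ_[2]) k‖ ≤ (2 : ℝ)⁻¹ ^ m)
    (hS : (2 : ℝ)⁻¹ ^ (m + 4) <
      ‖((ratTwistedSymbolSum f (ZMod.χ₈.ringHomComp (Int.castRingHom ℚ)) : ℚ) : ℚ_[2])‖) :
    (padicLFunction f (unitRoot W 2 : ℚ_[2])).order ≤ 3 :=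
  order_padicLFunction_le_of_chi8Floor hord hf 3 m hdiv (by simpa using hS)

/-- **The parity-free equality door (any level, any planted rank `n`).** Granting Kato's bound at
`2` (`corank_{ℤ₂} Sel_{2^∞}(E/ℚ) ≤ ord_{T=0} L₂(E,T)`), a planted `rank E(ℚ) ≥ n` and the χ₈-floor
`v₂(S₈(f)) ≤ m + n` give `rank E(ℚ) = corank_{ℤ₂} Sel_{2^∞}(E/ℚ) = ord_{T=0} L₂(E,T) = n` and
`corank Ш(E)[2^∞] = 0` (`n ≤ rank ≤ corank ≤ ord ≤ n`; no root number, no main conjecture).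
[cite: Kato2004Asterisque, Thm. 18.4 (p. 281)] [cite: MazurTateTeitelbaum1986Invent, §I.14 Proposition (p. 20)] -/
theorem rank_eq_selmerCorank_eq_order_of_chi8Floor
    (hord : IsOrdinaryAt W 2) (hf : IsNewformOf W f) (n m : ℕ)
    (hdiv : ∀ k : ℕ, ‖padicLCoeff f (unitRoot W 2 : ℚ_[2]) k‖ ≤ (2 : ℝ)⁻¹ ^ m)
    (hS : (2 : ℝ)⁻¹ ^ (m + n + 1) <
      ‖((ratTwistedSymbolSum f (ZMod.χ₈.ringHomComp (Int.castRingHom ℚ)) : ℚ) : ℚ_[2])‖)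
    (hKato : kato_selmerCorank_le_order_padicLFunction_allPrimes W 2 (f := f))
    (hrank : n ≤ W.mordellWeilRank) :
    W.mordellWeilRank = n ∧ W.selmerCorank 2 = n ∧ W.shaCorank 2 = 0 ∧
      (padicLFunction f (unitRoot W 2 : ℚ_[2])).order = n := by
  have hkum := W.selmerCorank_eq_mordellWeilRank_add_holds 2
  have hle := order_padicLFunction_le_of_chi8Floor hord hf n m hdiv hS
  have hKato' := hKato hord hf
  have hsel : (W.selmerCorank 2 : ℕ∞) ≤ n := hKato'.trans hle
  have hsel' : W.selmerCorank 2 ≤ n := by exact_mod_cast hsel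
  have hcn : (n : ℕ∞) ≤ W.selmerCorank 2 := by
    have : n ≤ W.selmerCorank 2 := by omega
    exact_mod_cast this
  exact ⟨by omega, by omega, by omega, le_antisymm hle (hcn.trans hKato')⟩

/-- The parity-free door with `m = 0` from INT2-AUTO: hypotheses = {good ordinary `2`, newform,
`v₂(S₈(f)) ≤ n`, Kato's bound at `2`, planted rank `≥ n`}.
[cite: Kato2004Asterisque, Thm. 18.4 (p. 281)] [cite: MazurTateTeitelbaum1986Invent, §I.14 Proposition (p. 20)] -/
theorem rank_eq_selmerCorank_eq_order_of_chi8Floor₀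
    (hord : IsOrdinaryAt W 2) (hf : IsNewformOf W f) (n : ℕ)
    (hS : (2 : ℝ)⁻¹ ^ (n + 1) <
      ‖((ratTwistedSymbolSum f (ZMod.χ₈.ringHomComp (Int.castRingHom ℚ)) : ℚ) : ℚ_[2])‖)
    (hKato : kato_selmerCorank_le_order_padicLFunction_allPrimes W 2 (f := f))
    (hrank : n ≤ W.mordellWeilRank) :
    W.mordellWeilRank = n ∧ W.selmerCorank 2 = n ∧ W.shaCorank 2 = 0 ∧
      (padicLFunction f (unitRoot W 2 : ℚ_[2])).order = n :=
  rank_eq_selmerCorank_eq_order_of_chi8Floor hord hf n 0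
    (fun k ↦ by simpa using padicLFunction_integral_two_auto hord hf k) (by simpa using hS)
    hKato hrank

/-- **The rank-3 equality door (any level, no sign hypothesis).** Granting Kato's bound at `2`
(`corank_{ℤ₂} Sel_{2^∞}(E/ℚ) ≤ ord_{T=0} L₂(E,T)`), a planted `rank E(ℚ) ≥ 3` and the χ₈-floor give
`rank E(ℚ) = corank_{ℤ₂} Sel_{2^∞}(E/ℚ) = ord_{T=0} L₂(E,T) = 3` and `corank Ш(E)[2^∞] = 0`.
[cite: Kato2004Asterisque, Thm. 18.4 (p. 281)] [cite: MazurTateTeitelbaum1986Invent, §I.14 Proposition (p. 20)] -/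
theorem rank_eq_selmerCorank_eq_order_eq_three_of_chi8Floor
    (hord : IsOrdinaryAt W 2) (hf : IsNewformOf W f) (m : ℕ)
    (hdiv : ∀ k : ℕ, ‖padicLCoeff f (unitRoot W 2 : ℚ_[2]) k‖ ≤ (2 : ℝ)⁻¹ ^ m)
    (hS : (2 : ℝ)⁻¹ ^ (m + 4) <
      ‖((ratTwistedSymbolSum f (ZMod.χ₈.ringHomComp (Int.castRingHom ℚ)) : ℚ) : ℚ_[2])‖)
    (hKato : kato_selmerCorank_le_order_padicLFunction_allPrimes W 2 (f := f))
    (hrank : 3 ≤ W.mordellWeilRank) :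
    W.mordellWeilRank = 3 ∧ W.selmerCorank 2 = 3 ∧ W.shaCorank 2 = 0 ∧
      (padicLFunction f (unitRoot W 2 : ℚ_[2])).order = 3 := by
  have h := rank_eq_selmerCorank_eq_order_of_chi8Floor hord hf 3 m hdiv (by simpa using hS) hKato hrank
  exact_mod_cast h

/-- The rank-3 door with `m = 0` supplied by INT2-AUTO: hypotheses = {good ordinary `2`, newform,
`v₂(S₈(f)) ≤ 3`, Kato's bound at `2`, planted rank `≥ 3`}.
[cite: Kato2004Asterisque, Thm. 18.4 (p. 281)] [cite: MazurTateTeitelbaum1986Invent, §I.14 Proposition (p. 20)] -/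
theorem rank_eq_selmerCorank_eq_order_eq_three_of_chi8Floor₀
    (hord : IsOrdinaryAt W 2) (hf : IsNewformOf W f)
    (hS : (2 : ℝ)⁻¹ ^ 4 <
      ‖((ratTwistedSymbolSum f (ZMod.χ₈.ringHomComp (Int.castRingHom ℚ)) : ℚ) : ℚ_[2])‖)
    (hKato : kato_selmerCorank_le_order_padicLFunction_allPrimes W 2 (f := f))
    (hrank : 3 ≤ W.mordellWeilRank) :
    W.mordellWeilRank = 3 ∧ W.selmerCorank 2 = 3 ∧ W.shaCorank 2 = 0 ∧
      (padicLFunction f (unitRoot W 2 : ℚ_[2])).order = 3 :=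
  rank_eq_selmerCorank_eq_order_eq_three_of_chi8Floor hord hf 0
    (fun k ↦ by simpa using padicLFunction_integral_two_auto hord hf k) (by simpa using hS)
    hKato hrank

end AnyLevel

section Eighth

/-! ### The eighth-symbol form: `S₈(f) = 4·[1/8]⁺_f` when `L(f,1) = 0` -/

variable {N : ℕ} [NeZero N]

omit [NeZero N] in
/-- Expansion of the `χ₈`-twisted symbol sum: `S₈(f) = [1/8]⁺ − [3/8]⁺ − [5/8]⁺ + [7/8]⁺`
(`χ₈ = (2/·)` takes the values `0,1,0,−1,0,−1,0,1` on `0,…,7`). [folklore] -/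
theorem ratTwistedSymbolSum_χ₈_expand (f : CuspForm (Gamma0 N) 2) :
    ratTwistedSymbolSum f (ZMod.χ₈.ringHomComp (Int.castRingHom ℚ)) =
      ratPlusSymbol f (1 / 8) - ratPlusSymbol f (3 / 8) - ratPlusSymbol f (5 / 8) +
        ratPlusSymbol f (7 / 8) := by
  unfold ratTwistedSymbolSum
  simp only [Rat.cast_id]
  change ∑ a : Fin 8, (ZMod.χ₈.ringHomComp (Int.castRingHom ℚ)) a *
      ratPlusSymbol f ((a.val : ℚ) / (8 : ℕ)) = _
  rw [Fin.sum_univ_eight]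
  simp only [MulChar.ringHomComp_apply]
  have h0 : (ZMod.χ₈ (0 : Fin 8) : ℤ) = 0 := by decide
  have h1 : (ZMod.χ₈ (1 : Fin 8) : ℤ) = 1 := by decide
  have h2 : (ZMod.χ₈ (2 : Fin 8) : ℤ) = 0 := by decide
  have h3 : (ZMod.χ₈ (3 : Fin 8) : ℤ) = -1 := by decide
  have h4 : (ZMod.χ₈ (4 : Fin 8) : ℤ) = 0 := by decide
  have h5 : (ZMod.χ₈ (5 : Fin 8) : ℤ) = -1 := by decide
  have h6 : (ZMod.χ₈ (6 : Fin 8) : ℤ) = 0 := by decide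
  have h7 : (ZMod.χ₈ (7 : Fin 8) : ℤ) = 1 := by decide
  have v1 : ((1 : Fin 8).val : ℚ) / (8 : ℕ) = 1 / 8 := by norm_num
  have v3 : ((3 : Fin 8).val : ℚ) / (8 : ℕ) = 3 / 8 := by
    rw [show (3 : Fin 8).val = 3 from rfl]; norm_num
  have v5 : ((5 : Fin 8).val : ℚ) / (8 : ℕ) = 5 / 8 := by
    rw [show (5 : Fin 8).val = 5 from rfl]; norm_num
  have v7 : ((7 : Fin 8).val : ℚ) / (8 : ℕ) = 7 / 8 := by
    rw [show (7 : Fin 8).val = 7 from rfl]; norm_num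
  rw [h0, h1, h2, h3, h4, h5, h6, h7, v1, v3, v5, v7]
  simp only [eq_intCast, Int.cast_zero, Int.cast_one, Int.cast_neg, zero_mul, zero_add, one_mul,
    neg_mul]
  ring

/-- With `[0]⁺_f = 0` (`L(f,1) = 0`) at odd level: `[1/2]⁺ = [1/4]⁺ = 0`, `[3/8]⁺ = [5/8]⁺ = −[1/8]⁺`,
`[7/8]⁺ = [1/8]⁺` — the Hecke relation at `2` (MTT (4.2)) at the cusps `0`, `1/2`, `1/4`
(`normalizedPlusSymbol_half_eq`, `two_mul_normalizedPlusSymbol_quarter_eq`,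
`intCast_mul_normalizedPlusSymbol`) and `[r+1]⁺ = [r]⁺ = [−r]⁺`.
[cite: MazurTateTeitelbaum1986Invent, §I.4 (4.2)] -/
theorem normalizedPlusSymbol_eighths_of_zero {f : CuspForm (Gamma0 N) 2} (hf : IsNewform0 f)
    (h2N : ¬ 2 ∣ N) {a₂ : ℤ} (ha₂ : cuspCoeff f 2 = a₂) (h0 : normalizedPlusSymbol f 0 = 0) :
    normalizedPlusSymbol f (1 / 2) = 0 ∧ normalizedPlusSymbol f (1 / 4) = 0 ∧
      normalizedPlusSymbol f (3 / 8) = -normalizedPlusSymbol f (1 / 8) ∧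
      normalizedPlusSymbol f (5 / 8) = -normalizedPlusSymbol f (1 / 8) ∧
      normalizedPlusSymbol f (7 / 8) = normalizedPlusSymbol f (1 / 8) := by
  have hhalf := normalizedPlusSymbol_half_eq hf h2N ha₂
  have hq := two_mul_normalizedPlusSymbol_quarter_eq hf h2N ha₂
  rw [h0, mul_zero] at hhalf hq
  have hq' : normalizedPlusSymbol f (1 / 4) = 0 := by linarith
  have h := intCast_mul_normalizedPlusSymbol 2 hf Nat.prime_two h2N ha₂ (1 / 4)
  rw [Fin.sum_univ_two] at h
  simp only [Fin.val_zero, Fin.val_one, Nat.cast_zero, Nat.cast_one, add_zero, Nat.cast_ofNat] at h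
  have e1 : (1 / 4 : ℚ) / 2 = 1 / 8 := by norm_num
  have e2 : ((1 / 4 : ℚ) + 1) / 2 = 5 / 8 := by norm_num
  have e3 : (2 : ℚ) * (1 / 4) = 1 / 2 := by norm_num
  rw [e1, e2, e3, hq', hhalf, mul_zero] at h
  have h58 : normalizedPlusSymbol f (5 / 8) = -normalizedPlusSymbol f (1 / 8) := by linarith
  have h38 : normalizedPlusSymbol f (3 / 8) = normalizedPlusSymbol f (5 / 8) := by
    have h' := normalizedPlusSymbol_add_intCast f (-(5 / 8 : ℚ)) 1
    rw [normalizedPlusSymbol_neg, show (-(5 / 8 : ℚ)) + ((1 : ℤ) : ℚ) = 3 / 8 by norm_num] at h'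
    exact h'
  have h78 : normalizedPlusSymbol f (7 / 8) = normalizedPlusSymbol f (1 / 8) := by
    have h' := normalizedPlusSymbol_add_intCast f (-(1 / 8 : ℚ)) 1
    rw [normalizedPlusSymbol_neg, show (-(1 / 8 : ℚ)) + ((1 : ℤ) : ℚ) = 7 / 8 by norm_num] at h'
    exact h'
  exact ⟨hhalf, hq', h38.trans h58, h58, h78⟩

/-- **`S₈(f) = 4·[1/8]⁺_f` when `L(f,1) = 0`**: for a rational newform of odd level with `[0]⁺_f = 0`,
`∑_{a mod 8} χ₈(a)[a/8]⁺_f = 4[1/8]⁺_f`. [cite: MazurTateTeitelbaum1986Invent, §I.4 (4.2) and §I.8] -/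
theorem ratTwistedSymbolSum_χ₈_eq_four_mul_eighth {f : CuspForm (Gamma0 N) 2} (hf : IsNewform0 f)
    (hQ : coeffField f = ⊥) (h2N : ¬ 2 ∣ N) {a₂ : ℤ} (ha₂ : cuspCoeff f 2 = a₂)
    (h0 : ratPlusSymbol f 0 = 0) :
    ratTwistedSymbolSum f (ZMod.χ₈.ringHomComp (Int.castRingHom ℚ)) =
      4 * ratPlusSymbol f (1 / 8) := by
  have hcast : ∀ r : ℚ, ((ratPlusSymbol f r : ℚ) : ℝ) = normalizedPlusSymbol f r :=
    fun r ↦ ratCast_ratPlusSymbol_holds hf hQ r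
  have h0' : normalizedPlusSymbol f 0 = 0 := by rw [← hcast 0, h0, Rat.cast_zero]
  obtain ⟨-, -, h38, h58, h78⟩ := normalizedPlusSymbol_eighths_of_zero hf h2N ha₂ h0'
  rw [ratTwistedSymbolSum_χ₈_expand]
  apply Rat.cast_injective (α := ℝ)
  push_cast
  rw [hcast, hcast, hcast, hcast, h38, h58, h78]
  ring

variable {W : WeierstrassCurve ℚ} [W.IsElliptic] [W.IsGloballyMinimal] {f : CuspForm (Gamma0 N) 2}

/-- **`S₈(f_E) = 4·[1/8]⁺` for `E` good ordinary at `2` with `L(E,1) = 0`** (newform `f` of `E`,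
any level — then odd; `[0]⁺_f = L(E,1)/Ω⁺_f = 0`). [cite: MazurTateTeitelbaum1986Invent, §I.4 (4.2) and §I.8] -/
theorem ratTwistedSymbolSum_χ₈_eq_four_mul_eighth_of_isNewformOf (hord : IsOrdinaryAt W 2)
    (hf : IsNewformOf W f) (hL : W.entireLFunction 1 = 0) :
    ratTwistedSymbolSum f (ZMod.χ₈.ringHomComp (Int.castRingHom ℚ)) =
      4 * ratPlusSymbol f (1 / 8) := by
  have hpos : 0 < plusPeriod f := IsNewform0.plusPeriod_pos_holds hf.1 hf.coeffField_eq_bot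
  have h0 : ratPlusSymbol f 0 = 0 := by
    have h1 := hf.ratPlusSymbol_zero_mul_plusPeriod
    rw [hL, Complex.zero_re] at h1
    have h2 : ((ratPlusSymbol f 0 : ℚ) : ℝ) = 0 := (mul_eq_zero.mp h1).resolve_right hpos.ne'
    exact_mod_cast h2
  exact ratTwistedSymbolSum_χ₈_eq_four_mul_eighth hf.1 hf.coeffField_eq_bot
    (not_dvd_level_of_isNewformOf hf hord.1)
    (cuspCoeff_eq_frobeniusTrace_of_isNewformOf_holds hf hord.1) h0

/-- Norm transfer: `‖[1/8]⁺‖₂ > 2^{-j}` and `L(E,1) = 0` give `‖S₈(f)‖₂ > 2^{-(j+2)}`. [folklore] -/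
theorem chi8Floor_of_eighthSymbol (hord : IsOrdinaryAt W 2) (hf : IsNewformOf W f)
    (hL : W.entireLFunction 1 = 0) (j : ℕ)
    (h8 : (2 : ℝ)⁻¹ ^ j < ‖((ratPlusSymbol f (1 / 8) : ℚ) : ℚ_[2])‖) :
    (2 : ℝ)⁻¹ ^ (j + 2) <
      ‖((ratTwistedSymbolSum f (ZMod.χ₈.ringHomComp (Int.castRingHom ℚ)) : ℚ) : ℚ_[2])‖ := by
  have h2 : ‖(2 : ℚ_[2])‖ = (2 : ℝ)⁻¹ := by
    have h := Padic.norm_p (p := 2)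
    simpa using h
  have h4 : ‖(4 : ℚ_[2])‖ = (2 : ℝ)⁻¹ ^ 2 := by
    rw [show (4 : ℚ_[2]) = 2 ^ 2 by norm_num, norm_pow, h2]
  rw [ratTwistedSymbolSum_χ₈_eq_four_mul_eighth_of_isNewformOf hord hf hL, Rat.cast_mul,
    Rat.cast_ofNat, norm_mul, h4, show j + 2 = 2 + j by ring, pow_add]
  exact mul_lt_mul_of_pos_left h8 (by positivity)

end Eighth

end Summit.BirchSwinnertonDyer.Rank2

end
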